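import Mathlib
import Summits.NavierStokesRegularity.NavierStokesRegularity.Theorems.EulerZoomLiouvillePowerGaugeEulerLiouvilleSelfSimilarTopBadNodeArcDynamics
import Summits.NavierStokesRegularity.NavierStokesRegularity.Theorems.EulerZoomLiouvillePowerGaugeEulerLiouvilleSelfSimilarTopBadNodeArcSpectral
import Summits.NavierStokesRegularity.NavierStokesRegularity.Theorems.EulerZoomLiouvillePowerGaugeEulerLiouvilleSelfSimilarTopBadNodeExitArcSide
import Summits.NavierStokesRegularity.NavierStokesRegularity.Theorems.EulerZoomLiouvillePowerGaugeEulerLiouvilleSelfSimilarTopBadNodeLandscapeTools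
import Summits.NavierStokesRegularity.NavierStokesRegularity.Theorems.EulerZoomLiouvillePowerGaugeEulerLiouvilleSelfSimilarTopBadNodeExitBumpTools
import Summits.NavierStokesRegularity.NavierStokesRegularity.Theorems.EulerZoomLiouvillePowerGaugeEulerLiouvilleSelfSimilarTopBadNodeExitTools
import HarnessLib.Audit

/-!
# Rung C1 of the crux `EulerZoomLiouville.PowerGaugeEulerLiouville`: the no-exit lemma, CASE (NT-bump) — NO THRESHOLD,
# THE TRAJECTORY SEES FORCING (blueprint §2, `false_of_exit_bump`)

Route №10 `EulerZoomLiouville`, crux E = stmt-NavierStokesRegularity-19832, rung C1; twenty-eighth file of the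
NODAL-CONTINUUM line (ns-typeII-p1 g7).  Setting as in `…ExitThreshold` (kernel graph with `V = φe`, `|φ(τ)| ≤ C₁τ²`,
`φ` `C₁δ`-Lipschitz; backward trajectory `Y` on `[0, t₁]`; tube coordinates; `M₁ = |φ(σ(t⋆))| ≥ m₊ > 0`;
`Θ = κM₁² + 9(1+K)ε²`, `S = 2(1+K)Θ`).
* `false_of_exit_bump` — if `p + m < S` throughout: GAIN `∫₀^{t₁} φ(σ)² ≥ M₁²/(5C₁δ)` from the bump interval
  `[|σ⋆| − M₁/(2C₁δ), |σ⋆|]` (`bump_of_sq_bound`, crossed during `[0, t⋆]` by `exists_crossing`, φ-dominance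
  `ρ√S ≤ M₁/8`, `integral_ge_of_dominated_deriv`); LOSSES at the exit (`hexp` at `Γ(σ₁)`; quadratic `≤ Q·S`, linear
  `≤ M₁η√S`, offset, cross — `landscape_deficit`, `landscape_offset_le`, `abs_fderiv_selfSimilarBernoulli_le`) each group
  `≤ (1−2γ)M₁²/(160C₁δ)` by `hrBump`, `hε3a`, `hε3b`: `ℋ(Y t₁) > ℋ(z)`, contradiction.

WHAT THIS IS NOT: not NS, not E, not yet the no-exit lemma — the last of its three cases.
[cite: ConstantinIgnatovaVicol2026Putative, §3.4.3–§3.5, §4 (local analysis not in print)] [cite: KatokHasselblatt1995, §6.2]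
-/

noncomputable section

-- flat `Theorems/<Route><Decl>…` files of one crux share the namespace of the crux (tree convention)
set_option linter.dupNamespace false

open Set Filter Topology Metric Function InnerProductSpace MeasureTheory intervalIntegral
open scoped RealInnerProductSpace NNReal

namespace Summit.NavierStokesRegularity.NavierStokesRegularity.Theorems.PowerGaugeEulerLiouville.NodalContinuum

open Literature.Analysis Literature.Analysis.FluidPDE Literature.Analysis.ODE
open Summit.NavierStokesRegularity.NavierStokesRegularity.Theorems.PowerGaugeEulerLiouville.NodalFiniteness

variable {γ C : ℝ} {c : EuclideanSpace ℝ (Fin 3)}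
  {U : EuclideanSpace ℝ (Fin 3) → EuclideanSpace ℝ (Fin 3)} {P : EuclideanSpace ℝ (Fin 3) → ℝ}

set_option maxHeartbeats 800000 in
/-- **CASE (NT-bump) of the no-exit lemma: no threshold and positive trajectory forcing ⇒ contradiction.**  See the module
docstring; hypotheses = the relevant part of the blueprint's COMMON HYPOTHESES + the case data.
[cite: ConstantinIgnatovaVicol2026Putative, §3.4.3–§3.5, §4 (local analysis not in print)] [cite: KatokHasselblatt1995, §6.2 (cone criterion)] -/
theorem false_of_exit_bump (h : IsSelfSimilarEulerProfile γ c U P) (hγ2 : γ < 1 / 2)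
    {z : EuclideanSpace ℝ (Fin 3)} (hΩz : curl U z = 0)
    {e : EuclideanSpace ℝ (Fin 3)} (he1 : ‖e‖ = 1) (hAe : fderiv ℝ (selfSimilarTransport γ c U) z e = 0)
    {b : OrthonormalBasis (Fin 3) ℝ (EuclideanSpace ℝ (Fin 3))} {a : Fin 3 → ℝ} {μ α K : ℝ}
    (hb : ∀ i, fderiv ℝ (selfSimilarTransport γ c U) z (b i) = a i • b i) (hμ : 0 < μ) (hμα : μ ≤ α)
    (hpos_i : ∀ i, 0 < a i → μ ≤ a i)
    (hneg_i : ∀ ξ : EuclideanSpace ℝ (Fin 3), ⟪e, ξ⟫ = 0 → ∀ i, ¬ 0 < a i → a i ≤ -μ ∨ ⟪b i, ξ⟫ = 0)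
    (hK : K = 2 * α / μ + 1)
    {g g' : ℝ → EuclideanSpace ℝ (Fin 3)} {φ : ℝ → ℝ} {δ L C₁ : ℝ} (hδ : 0 < δ) (hL : 0 ≤ L) (hC₁pos : 0 < C₁)
    (hg0 : g 0 = 0) (hge : ∀ τ, ⟪e, g τ⟫ = 0) (hgd : ∀ τ, HasDerivAt g (g' τ) τ)
    (hg' : ∀ τ, |τ| ≤ δ → ‖g' τ‖ ≤ L * |τ|)
    (hpar : ∀ τ, |τ| ≤ δ → selfSimilarTransport γ c U (z + τ • e + g τ) = φ τ • e)
    (hφc : Continuous φ) (hφsq : ∀ τ, |τ| ≤ δ → |φ τ| ≤ C₁ * τ ^ 2)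
    (hφlip : ∀ τ τ', |τ| ≤ δ → |τ'| ≤ δ → |φ τ - φ τ'| ≤ C₁ * δ * |τ - τ'|)
    {ρ η ν Cν : ℝ} (hρ : 0 < ρ) (hη : 0 < η) (hν : 0 < ν) (hCν : 0 ≤ Cν)
    (hηU : ∀ y ∈ closedBall z δ, 2 * ‖fderiv ℝ U y - fderiv ℝ U z‖ ≤ η)
    (hexp : ∀ y : EuclideanSpace ℝ (Fin 3), ‖y - z‖ ≤ δ → ∀ ζ : EuclideanSpace ℝ (Fin 3), ‖ζ‖ ≤ δ →
      selfSimilarBernoulli γ c U P y + fderiv ℝ (selfSimilarBernoulli γ c U P) y ζ +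
          (1 / 2 * ((2 * γ - 1) * ⟪fderiv ℝ (selfSimilarTransport γ c U) z ζ, ζ⟫) -
            (ν + Cν * ‖selfSimilarTransport γ c U y‖) * ‖ζ‖ ^ 2) ≤
        selfSimilarBernoulli γ c U P (y + ζ))
    {Y : ℝ → EuclideanSpace ℝ (Fin 3)} {r ε C₃ t₁ : ℝ} (hr : 0 < r) (hrδ : 4 * r ≤ δ) (hε : 0 < ε) (hεr : ε ≤ r / 8)
    (hC₃ : 0 ≤ C₃)
    (hY : ∀ t, HasDerivAt Y ((-1 : ℝ) • selfSimilarTransport γ c U (Y t)) t) (ht₁ : 0 < t₁)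
    (hin : ∀ t ∈ Icc 0 t₁, ‖Y t - z‖ ≤ r) (hY0 : ‖Y 0 - z‖ < ε)
    (hHlt : selfSimilarBernoulli γ c U P (Y t₁) < selfSimilarBernoulli γ c U P z)
    (hH0 : selfSimilarBernoulli γ c U P z - C₃ * ε ^ 2 ≤ selfSimilarBernoulli γ c U P (Y 0))
    {σ p m : ℝ → ℝ} {ξ : ℝ → EuclideanSpace ℝ (Fin 3)} (hσ : ∀ t, σ t = ⟪e, Y t - z⟫)
    (hξ : ∀ t, ξ t = Y t - z - σ t • e - g (σ t))
    (hpm : ∀ t, p t + m t = ‖ξ t‖ ^ 2) (hmnn : ∀ t, 0 ≤ m t)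
    (hAξ : ∀ t, ⟪fderiv ℝ (selfSimilarTransport γ c U) z (ξ t), ξ t⟫ ≤ α * p t - μ * m t)
    (hσ' : ∀ t, HasDerivAt σ (-φ (σ t) - ⟪e, selfSimilarTransport γ c U (Y t) - φ (σ t) • e -
      fderiv ℝ (selfSimilarTransport γ c U) z (ξ t)⟫) t)
    (hE : ∀ t ∈ Icc 0 t₁, ‖selfSimilarTransport γ c U (Y t) - φ (σ t) • e -
      fderiv ℝ (selfSimilarTransport γ c U) z (ξ t)‖ ≤ ρ * ‖ξ t‖)
    {M₁ Θ κ : ℝ} (hM₁ : ∀ t ∈ Icc 0 t₁, |φ (σ t)| ≤ M₁)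
    (hκ : κ = 512 * η ^ 2 / ((1 - 2 * γ) ^ 2 * μ ^ 2) + 16 * (1 + K) * (L * r) ^ 2 / μ ^ 2)
    (hΘ : Θ = κ * M₁ ^ 2 + 9 * (1 + K) * ε ^ 2)
    (hρ2 : ρ ≤ μ / 2)
    (hsmall : ∀ t ∈ Icc 0 t₁, p t + m t < 2 * (1 + K) * Θ)
    {tstar mplus : ℝ} (htstar : tstar ∈ Icc 0 t₁) (hmax : |φ (σ tstar)| = M₁) (hmplus : 0 < mplus)
    (hmplusM : mplus ≤ M₁) (hrθ : η * (1 + 2 * L * r) ≤ (1 - 2 * γ) / 2) (hLr : L * r ≤ 1 / 4)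
    (hρ3 : ρ * Real.sqrt (2 * (1 + K)) * Real.sqrt κ ≤ 1 / 16)
    (hε1 : ε < Real.sqrt (mplus / C₁) / 2)
    (hε2 : ρ * (Real.sqrt (2 * (1 + K)) * (3 * Real.sqrt (1 + K)) * ε) ≤ mplus / 16)
    (hrBump : ((1 - 2 * γ) * α / 2 + ν + Cν * C₁ * r ^ 2) * (2 * (1 + K)) * κ +
        η * Real.sqrt (2 * (1 + K)) * Real.sqrt κ ≤ (1 - 2 * γ) / (160 * C₁ * δ))
    (hε3a : η * Real.sqrt (2 * (1 + K)) * (3 * Real.sqrt (1 + K)) * ε ≤ (1 - 2 * γ) * mplus / (160 * C₁ * δ))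
    (hε3b : ((1 - 2 * γ) * α / 2 + ν + Cν * C₁ * r ^ 2) * (2 * (1 + K)) * (9 * (1 + K) * ε ^ 2) +
        3 * (1 - 2 * γ) * C₁ * ε ^ 3 / 2 + 3 * ρ ^ 2 * C₃ * ε ^ 2 / μ ^ 2 ≤
        (1 - 2 * γ) * mplus ^ 2 / (160 * C₁ * δ)) : False := by
  classical
  set V := selfSimilarTransport γ c U with hV
  set A : EuclideanSpace ℝ (Fin 3) →L[ℝ] EuclideanSpace ℝ (Fin 3) := fderiv ℝ V z with hAdef
  set Hb := selfSimilarBernoulli γ c U P with hHb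
  have h12 : 0 < 1 - 2 * γ := by linarith
  have hC₁ : 0 ≤ C₁ := hC₁pos.le
  have hM₁0 : 0 ≤ M₁ := hmplus.le.trans hmplusM
  have hM₁pos : 0 < M₁ := hmplus.trans_le hmplusM
  have hKge1 : 1 ≤ K := by
    have : 0 ≤ 2 * α / μ := div_nonneg (by linarith) hμ.le
    rw [hK]; linarith
  have hA : (A : EuclideanSpace ℝ (Fin 3) →ₗ[ℝ] EuclideanSpace ℝ (Fin 3)).IsSymmetric :=
    isSymmetric_fderiv_transport_of_curl_eq_zero h hΩz
  have hee : ⟪e, e⟫ = 1 := by rw [real_inner_self_eq_norm_sq, he1]; norm_num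
  have hAe' : A e = 0 := hAe
  have hσle : ∀ t ∈ Icc 0 t₁, |σ t| ≤ r := fun t ht => by
    rw [hσ t]; exact ((abs_real_inner_le_norm e _).trans (by rw [he1, one_mul])).trans (hin t ht)
  have hLr4 : ∀ τ, |τ| ≤ r → ‖g τ‖ ≤ |τ| / 4 := fun τ hτ =>
    (norm_graph_le_quarter he1 hL hr hrδ hLr hg0 hgd hg' hτ).1
  have hΓz : ∀ τ, |τ| ≤ r → ‖τ • e + g τ‖ ≤ 2 * r := fun τ hτ =>
    (norm_graph_le_quarter he1 hL hr hrδ hLr hg0 hgd hg' hτ).2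
  have hξe : ∀ t, ⟪e, ξ t⟫ = 0 := by
    intro t; rw [hξ t, inner_sub_right, inner_sub_right, inner_smul_right, hee, hge, ← hσ t]; ring
  have hYΓξ : ∀ t, Y t = (z + σ t • e + g (σ t)) + ξ t := by intro t; rw [hξ t]; abel
  have hξle : ∀ t ∈ Icc 0 t₁, ‖ξ t‖ ≤ 3 * r := by
    intro t ht
    have e1 : ξ t = (Y t - z) - (σ t • e + g (σ t)) := by rw [hξ t]; abel
    rw [e1]
    exact (norm_sub_le _ _).trans (by linarith [hin t ht, hΓz (σ t) (hσle t ht)])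
  have ht₁m : t₁ ∈ Icc 0 t₁ := ⟨ht₁.le, le_rfl⟩
  have hσ0 : |σ 0| ≤ ε := by
    rw [hσ 0]; exact ((abs_real_inner_le_norm e _).trans (by rw [he1, one_mul])).trans hY0.le
  set S : ℝ := 2 * (1 + K) * Θ with hS
  have hκ0 : 0 ≤ κ := by rw [hκ]; positivity
  have hΘ0 : 0 ≤ Θ := by rw [hΘ]; positivity
  have hS0 : 0 ≤ S := by positivity
  have hξS : ∀ t ∈ Icc 0 t₁, ‖ξ t‖ ≤ Real.sqrt S := by
    intro t ht
    rw [← Real.sqrt_sq (norm_nonneg (ξ t)), ← hpm t]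
    exact Real.sqrt_le_sqrt (hsmall t ht).le
  have hsqS' : Real.sqrt S ≤ Real.sqrt (2 * (1 + K)) * Real.sqrt κ * M₁ +
      Real.sqrt (2 * (1 + K)) * (3 * Real.sqrt (1 + K)) * ε := by
    rw [hS, hΘ]; exact sqrt_S_le hκ0 hM₁0 (by linarith) hε.le
  have hρS : ρ * Real.sqrt S ≤ M₁ / 8 := by
    have h1 := mul_le_mul_of_nonneg_left hsqS' hρ.le
    have h2 : ρ * (Real.sqrt (2 * (1 + K)) * Real.sqrt κ * M₁) ≤ 1 / 16 * M₁ := by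
      have := mul_le_mul_of_nonneg_right hρ3 hM₁0
      linarith
    linarith
  have hEe : ∀ t ∈ Icc 0 t₁, |⟪e, V (Y t) - φ (σ t) • e - A (ξ t)⟫| ≤ M₁ / 8 := by
    intro t ht
    have h1 := hE t ht
    have h2 : ρ * ‖ξ t‖ ≤ ρ * Real.sqrt S := mul_le_mul_of_nonneg_left (hξS t ht) hρ.le
    exact ((abs_real_inner_le_norm _ _).trans (by rw [he1, one_mul])).trans (h1.trans (h2.trans hρS))
  set σs : ℝ := |σ tstar| with hσs
  have hσsr : σs ≤ r := hσle tstar htstar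
  obtain ⟨s, hs1, hsσ⟩ : ∃ s : ℝ, s * s = 1 ∧ s * σ tstar = σs := by
    rcases le_or_gt 0 (σ tstar) with h0 | h0
    · exact ⟨1, by norm_num, by rw [one_mul, hσs, abs_of_nonneg h0]⟩
    · exact ⟨-1, by norm_num, by rw [hσs, abs_of_neg h0]; ring⟩
  have hsabs : |s| = 1 := by
    have : |s| * |s| = 1 := by rw [← abs_mul, hs1, abs_one]
    rcases mul_self_eq_one_iff.1 this with h1 | h1
    · exact h1
    · linarith [abs_nonneg s]
  set ψ : ℝ → ℝ := fun τ => φ (s * τ) with hψ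
  set u : ℝ → ℝ := fun t => s * σ t with hu
  have hφψ : ∀ t, φ (σ t) = ψ (u t) := by
    intro t; simp only [hψ, hu]; rw [← mul_assoc, hs1, one_mul]
  have hψM : |ψ σs| = M₁ := by
    rw [← hmax, hφψ tstar]
    show |ψ σs| = |ψ (s * σ tstar)|
    rw [hsσ]
  have hσs_big : 2 * ε < σs := by
    have h1 : M₁ ≤ C₁ * σs ^ 2 := by
      rw [← hmax, hσs, sq_abs]; exact hφsq _ ((hσle tstar htstar).trans (by linarith))
    have h2 : mplus / C₁ ≤ σs ^ 2 := by rw [div_le_iff₀ hC₁pos]; linarith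
    have hσs0 : 0 ≤ σs := by rw [hσs]; exact abs_nonneg _
    have h3 : Real.sqrt (mplus / C₁) ≤ σs :=
      calc Real.sqrt (mplus / C₁) ≤ Real.sqrt (σs ^ 2) := Real.sqrt_le_sqrt h2
        _ = σs := Real.sqrt_sq hσs0
    linarith
  have hbump := bump_of_sq_bound (φ := ψ) (ℓ := C₁ * δ) (C₁ := C₁) (b := r) (σs := σs)
    (by positivity) hC₁ (mul_le_mul_of_nonneg_left (by linarith) hC₁) (fun τ hτ τ' hτ' => by
      simp only [hψ]
      have h1 := hφlip (s * τ) (s * τ') (by rw [abs_mul, hsabs, one_mul, abs_of_nonneg hτ.1]; linarith [hτ.2])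
        (by rw [abs_mul, hsabs, one_mul, abs_of_nonneg hτ'.1]; linarith [hτ'.2])
      rwa [← mul_sub, abs_mul, hsabs, one_mul] at h1)
    (fun τ hτ => by
      simp only [hψ]
      have h1 := hφsq (s * τ) (by rw [abs_mul, hsabs, one_mul, abs_of_nonneg hτ.1]; linarith [hτ.2])
      rwa [mul_pow, show s ^ 2 = 1 by rw [sq, hs1], one_mul] at h1)
    ⟨abs_nonneg _, hσsr⟩
  rw [hψM] at hbump
  obtain ⟨hIb_left, hIb_big⟩ := hbump
  set aa : ℝ := σs - M₁ / (2 * (C₁ * δ)) with haa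
  have hℓpos : 0 < M₁ / (2 * (C₁ * δ)) := by positivity
  have haa_lt : aa < σs := by rw [haa]; linarith
  have hYc : Continuous Y := continuous_iff_continuousAt.2 fun t => (hY t).continuousAt
  have hσc : Continuous σ := by
    have : σ = fun t => ⟪e, Y t - z⟫ := funext hσ
    rw [this]; exact continuous_const.inner (hYc.sub continuous_const)
  have huc : Continuous u := continuous_const.mul hσc
  have hu0 : u 0 ≤ aa := by
    have : u 0 ≤ ε := by
      simp only [hu]
      calc s * σ 0 ≤ |s * σ 0| := le_abs_self _
        _ = |σ 0| := by rw [abs_mul, hsabs, one_mul]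
        _ ≤ ε := hσ0
    linarith
  have huT : σs ≤ u tstar := by simp only [hu]; rw [hsσ]
  obtain ⟨ta, tb, hta0, htab, htbT, huta, hutb, hucross⟩ :=
    exists_crossing huc htstar.1 haa_lt hu0 huT
  have hsubab : Icc ta tb ⊆ Icc 0 t₁ := Icc_subset_Icc hta0 (htbT.trans htstar.2)
  have hφbig : ∀ t ∈ Icc ta tb, M₁ / 2 ≤ |φ (σ t)| := by
    intro t ht
    rw [hφψ t]
    exact hIb_big (u t) (hucross t ht)
  set σd : ℝ → ℝ := fun t => -φ (σ t) - ⟪e, V (Y t) - φ (σ t) • e - A (ξ t)⟫ with hσd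
  have hσ'' : ∀ t, HasDerivAt σ (σd t) t := fun t => by rw [hσd]; exact hσ' t
  have hdom : ∀ t ∈ Icc ta tb, 2 * M₁ / 5 * |σd t| ≤ φ (σ t) ^ 2 := by
    intro t ht
    have h1 := hEe t (hsubab ht)
    have h2 := hφbig t ht
    have h3 : |σd t| ≤ 5 / 4 * |φ (σ t)| := by
      simp only [hσd]
      calc |-φ (σ t) - ⟪e, V (Y t) - φ (σ t) • e - A (ξ t)⟫|
          ≤ |-φ (σ t)| + |⟪e, V (Y t) - φ (σ t) • e - A (ξ t)⟫| := abs_sub _ _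
        _ ≤ |φ (σ t)| + M₁ / 8 := by rw [abs_neg]; exact add_le_add le_rfl h1
        _ ≤ 5 / 4 * |φ (σ t)| := by linarith
    have h4 : φ (σ t) ^ 2 = |φ (σ t)| * |φ (σ t)| := by rw [← sq_abs, sq]
    rw [h4]
    have h5 : 2 * M₁ / 5 * |σd t| ≤ 2 * M₁ / 5 * (5 / 4 * |φ (σ t)|) :=
      mul_le_mul_of_nonneg_left h3 (by positivity)
    have h6 : 2 * M₁ / 5 * (5 / 4 * |φ (σ t)|) = M₁ / 2 * |φ (σ t)| := by ring
    have h7 : M₁ / 2 * |φ (σ t)| ≤ |φ (σ t)| * |φ (σ t)| :=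
      mul_le_mul_of_nonneg_right h2 (abs_nonneg _)
    linarith
  have hVc : Continuous V := by
    have e1 : V = fun y => γ • (y - c) + U y := rfl
    rw [e1]
    exact ((continuous_id.sub continuous_const).const_smul γ).add h.contDiff_velocity.continuous
  have hgc : Continuous g := continuous_iff_continuousAt.2 fun τ => (hgd τ).continuousAt
  have hξc : Continuous ξ := by
    have : ξ = fun t => Y t - z - σ t • e - g (σ t) := funext hξ
    rw [this]
    exact ((hYc.sub continuous_const).sub (hσc.smul continuous_const)).sub (hgc.comp hσc)
  have hσdc : Continuous σd := by
    simp only [hσd]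
    exact (hφc.comp hσc).neg.sub (continuous_const.inner
      (((hVc.comp hYc).sub ((hφc.comp hσc).smul continuous_const)).sub (A.continuous.comp hξc)))
  have hφσc : Continuous fun t => φ (σ t) ^ 2 := (hφc.comp hσc).pow 2
  have hgain : M₁ ^ 2 / (5 * C₁ * δ) ≤ ∫ t in (0:ℝ)..t₁, φ (σ t) ^ 2 := by
    have h1 := integral_ge_of_dominated_deriv (f := fun t => φ (σ t) ^ 2) (by positivity : (0:ℝ) ≤ 2 * M₁ / 5)
      hσ'' hσdc hφσc (fun t => sq_nonneg _) hta0 htab.le (htbT.trans htstar.2) hdom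
    have hlen : M₁ / (2 * (C₁ * δ)) ≤ |σ tb - σ ta| := by
      have e1 : |σ tb - σ ta| = |u tb - u ta| := by
        simp only [hu]; rw [← mul_sub, abs_mul, hsabs, one_mul]
      rw [e1, hutb, huta, haa]
      rw [abs_of_nonneg (by linarith)]; linarith
    have h3 : 2 * M₁ / 5 * (M₁ / (2 * (C₁ * δ))) ≤ 2 * M₁ / 5 * |σ tb - σ ta| :=
      mul_le_mul_of_nonneg_left hlen (by positivity)
    have e1 : M₁ ^ 2 / (5 * C₁ * δ) = 2 * M₁ / 5 * (M₁ / (2 * (C₁ * δ))) := by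
      rw [div_eq_iff (by positivity)]
      field_simp
    rw [e1]
    exact h3.trans h1
  have hQ0 : 0 ≤ (1 - 2 * γ) * α / 2 + ν + Cν * C₁ * r ^ 2 := by
    have h1 : 0 ≤ (1 - 2 * γ) * α := mul_nonneg h12.le (by linarith)
    have h2 : 0 ≤ Cν * C₁ * r ^ 2 := by positivity
    linarith [hν.le]
  set σ₁ := σ t₁ with hσ₁
  set ξ₁ := ξ t₁ with hξ₁
  set Γ₁ : EuclideanSpace ℝ (Fin 3) := z + σ₁ • e + g σ₁ with hΓ₁
  have hY₁ : Y t₁ = Γ₁ + ξ₁ := hYΓξ t₁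
  have hσ₁r : |σ₁| ≤ r := hσle t₁ ht₁m
  have hΓ₁z : ‖Γ₁ - z‖ ≤ δ := by
    have e1 : Γ₁ - z = σ₁ • e + g σ₁ := by rw [hΓ₁]; abel
    rw [e1]; linarith [hΓz σ₁ hσ₁r]
  have hξ₁δ : ‖ξ₁‖ ≤ δ := (hξle t₁ ht₁m).trans (by linarith)
  have hVΓ₁ : V Γ₁ = φ σ₁ • e := hpar σ₁ (hσ₁r.trans (by linarith))
  have hφ₁ : |φ σ₁| ≤ M₁ := hM₁ t₁ ht₁m
  have hφ₁r : |φ σ₁| ≤ C₁ * r ^ 2 := by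
    have h1 := hφsq σ₁ (hσ₁r.trans (by linarith))
    have h2 : σ₁ ^ 2 ≤ r ^ 2 := by rw [← sq_abs]; exact pow_le_pow_left₀ (abs_nonneg _) hσ₁r 2
    exact h1.trans (mul_le_mul_of_nonneg_left h2 hC₁)
  have hVΓ₁n : ‖V Γ₁‖ ≤ C₁ * r ^ 2 := by
    rw [hVΓ₁, norm_smul, Real.norm_eq_abs, he1, mul_one]; exact hφ₁r
  have hexp₁ := hexp Γ₁ hΓ₁z ξ₁ hξ₁δ
  rw [← hY₁] at hexp₁
  have hξ₁S : ‖ξ₁‖ ^ 2 ≤ S := by rw [← hpm t₁]; exact (hsmall t₁ ht₁m).le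
  have hξ₁S' : ‖ξ₁‖ ≤ Real.sqrt S := hξS t₁ ht₁m
  have hquad : -(((1 - 2 * γ) * α / 2 + ν + Cν * C₁ * r ^ 2) * S) ≤
      1 / 2 * ((2 * γ - 1) * ⟪A ξ₁, ξ₁⟫) - (ν + Cν * ‖V Γ₁‖) * ‖ξ₁‖ ^ 2 := by
    have h1 : ⟪A ξ₁, ξ₁⟫ ≤ α * p t₁ - μ * m t₁ := hAξ t₁
    have h2 : α * p t₁ ≤ α * ‖ξ₁‖ ^ 2 := by
      rw [← hpm t₁]; exact mul_le_mul_of_nonneg_left (by linarith [hmnn t₁]) (by linarith)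
    have h3 : ⟪A ξ₁, ξ₁⟫ ≤ α * ‖ξ₁‖ ^ 2 := by
      have : 0 ≤ μ * m t₁ := mul_nonneg hμ.le (hmnn t₁)
      linarith
    have h4 : (1 - 2 * γ) * ⟪A ξ₁, ξ₁⟫ ≤ (1 - 2 * γ) * (α * ‖ξ₁‖ ^ 2) := mul_le_mul_of_nonneg_left h3 h12.le
    have h5 : (ν + Cν * ‖V Γ₁‖) * ‖ξ₁‖ ^ 2 ≤ (ν + Cν * C₁ * r ^ 2) * ‖ξ₁‖ ^ 2 := by
      apply mul_le_mul_of_nonneg_right _ (sq_nonneg _)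
      have := mul_le_mul_of_nonneg_left hVΓ₁n hCν; linarith
    have h6 : ((1 - 2 * γ) * α / 2 + ν + Cν * C₁ * r ^ 2) * ‖ξ₁‖ ^ 2 ≤
        ((1 - 2 * γ) * α / 2 + ν + Cν * C₁ * r ^ 2) * S :=
      mul_le_mul_of_nonneg_left hξ₁S hQ0
    linarith only [h4, h5, h6]
  have hlin : |fderiv ℝ Hb Γ₁ ξ₁| ≤ M₁ * η * Real.sqrt S := by
    have h1 := abs_fderiv_selfSimilarBernoulli_le h hΩz he1 hVΓ₁ (hξe t₁)
    rw [← hHb] at h1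
    have hDn : 2 * ‖fderiv ℝ U Γ₁ - fderiv ℝ U z‖ ≤ η :=
      hηU Γ₁ (by rw [mem_closedBall, dist_eq_norm]; exact hΓ₁z)
    calc |fderiv ℝ Hb Γ₁ ξ₁| ≤ |φ σ₁| * (2 * ‖fderiv ℝ U Γ₁ - fderiv ℝ U z‖) * ‖ξ₁‖ := h1
      _ ≤ M₁ * η * Real.sqrt S := by
          apply mul_le_mul _ hξ₁S' (norm_nonneg _) (by positivity)
          exact mul_le_mul hφ₁ hDn (by positivity) hM₁0
  have hθ : ∀ τ, |τ| ≤ r → 2 * ‖fderiv ℝ U (z + τ • e + g τ) - fderiv ℝ U z‖ * ‖e + g' τ‖ ≤ (1 - 2 * γ) / 2 :=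
    fun τ hτ => (landscape_slope_bound he1 hL hr hrδ hη.le hg' hΓz hηU hτ).trans hrθ
  have hparr : ∀ τ, |τ| ≤ r → V (z + τ • e + g τ) = φ τ • e := fun τ hτ =>
    hpar τ (hτ.trans (by linarith only [hrδ, hr]))
  have hσr : ∀ t ∈ Icc 0 t₁, |⟪e, Y t - z⟫| ≤ r := fun t ht => by rw [← hσ t]; exact hσle t ht
  have hdev : ∀ t ∈ Icc 0 t₁, (⟪e, V (Y t)⟫ - φ ⟪e, Y t - z⟫) ^ 2 ≤ 4 * ρ ^ 2 / μ ^ 2 * ‖V (Y t)‖ ^ 2 := by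
    intro t ht
    rw [← hσ t]
    exact (norm_transport_ge_of_tube hA b hb hμ hpos_i he1 hAe' (hneg_i (ξ t) (hξe t)) (hE t ht) hρ2).2
  have hdef := landscape_deficit h hγ2 hΩz he1 hge hgd hφc hparr hθ hY ht₁.le hσr hμ hdev hHlt hH0
  simp only [← hσ] at hdef
  rw [← hHb] at hdef
  have hφε : ∀ τ, |τ| ≤ ε → |φ τ| ≤ C₁ * ε ^ 2 := by
    intro τ hτ
    have h1 := hφsq τ (hτ.trans (by linarith only [hεr, hrδ, hr]))
    have h2 : τ ^ 2 ≤ ε ^ 2 := by rw [← sq_abs]; exact pow_le_pow_left₀ (abs_nonneg _) hτ 2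
    exact h1.trans (mul_le_mul_of_nonneg_left h2 hC₁)
  have hoff := landscape_offset_le h hγ2 hΩz he1 hg0 hge hgd (by linarith only [hεr, hr] : ε ≤ r)
    (by positivity : (0:ℝ) ≤ C₁ * ε ^ 2) hparr hθ hφε hσ0
  rw [← hHb] at hoff
  have hoff' : Hb z - 3 * (1 - 2 * γ) * C₁ * ε ^ 3 / 2 ≤ Hb (z + σ 0 • e + g (σ 0)) := by
    have h1 := (abs_le.1 hoff).1
    have h2 : 3 * (1 - 2 * γ) / 2 * (C₁ * ε ^ 2) * |σ 0| ≤ 3 * (1 - 2 * γ) / 2 * (C₁ * ε ^ 2) * ε :=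
      mul_le_mul_of_nonneg_left hσ0 (by positivity)
    linarith only [h1, h2]
  have hland : Hb z - 3 * (1 - 2 * γ) * C₁ * ε ^ 3 / 2 - 3 * ρ ^ 2 * C₃ * ε ^ 2 / μ ^ 2 +
      (1 - 2 * γ) / 4 * (M₁ ^ 2 / (5 * C₁ * δ)) ≤ Hb Γ₁ := by
    have hG₁ : Hb (z + σ t₁ • e + g (σ t₁)) = Hb Γ₁ := by simp only [hΓ₁, hσ₁]
    have h1 := mul_le_mul_of_nonneg_left hgain (by positivity : (0:ℝ) ≤ (1 - 2 * γ) / 4)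
    linarith only [hdef, hoff', h1, hG₁]
  set Q : ℝ := (1 - 2 * γ) * α / 2 + ν + Cν * C₁ * r ^ 2 with hQ
  set G₀ : ℝ := (1 - 2 * γ) * M₁ ^ 2 / (160 * C₁ * δ) with hG₀
  have hG₀pos : 0 < G₀ := by positivity
  have hgainval : (1 - 2 * γ) / 4 * (M₁ ^ 2 / (5 * C₁ * δ)) = 8 * G₀ := by
    rw [hG₀]; field_simp; ring
  have hSexp : S = 2 * (1 + K) * κ * M₁ ^ 2 + 2 * (1 + K) * (9 * (1 + K) * ε ^ 2) := by rw [hS, hΘ]; ring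
  have hloss1 : Q * (2 * (1 + K) * κ * M₁ ^ 2) + M₁ * η * (Real.sqrt (2 * (1 + K)) * Real.sqrt κ * M₁) ≤ G₀ := by
    have h1 := mul_le_mul_of_nonneg_right hrBump (sq_nonneg M₁)
    have e1 : (Q * (2 * (1 + K)) * κ + η * Real.sqrt (2 * (1 + K)) * Real.sqrt κ) * M₁ ^ 2 =
        Q * (2 * (1 + K) * κ * M₁ ^ 2) + M₁ * η * (Real.sqrt (2 * (1 + K)) * Real.sqrt κ * M₁) := by ring
    have e2 : (1 - 2 * γ) / (160 * C₁ * δ) * M₁ ^ 2 = G₀ := by rw [hG₀]; ring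
    linarith only [h1, e1, e2]
  have hloss2 : M₁ * η * (Real.sqrt (2 * (1 + K)) * (3 * Real.sqrt (1 + K)) * ε) ≤ G₀ := by
    have h1 := mul_le_mul_of_nonneg_left hε3a hM₁0
    have h2 := mul_le_mul_of_nonneg_left hmplusM (by positivity : (0:ℝ) ≤ (1 - 2 * γ) * M₁ / (160 * C₁ * δ))
    have e1 : M₁ * ((1 - 2 * γ) * mplus / (160 * C₁ * δ)) = (1 - 2 * γ) * M₁ / (160 * C₁ * δ) * mplus := by ring
    have e2 : (1 - 2 * γ) * M₁ / (160 * C₁ * δ) * M₁ = G₀ := by rw [hG₀]; ring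
    linarith
  have hloss3 : Q * (2 * (1 + K) * (9 * (1 + K) * ε ^ 2)) + 3 * (1 - 2 * γ) * C₁ * ε ^ 3 / 2 +
      3 * ρ ^ 2 * C₃ * ε ^ 2 / μ ^ 2 ≤ G₀ := by
    have h2 : (1 - 2 * γ) * mplus ^ 2 / (160 * C₁ * δ) ≤ G₀ := by
      rw [hG₀]
      apply div_le_div_of_nonneg_right _ (by positivity)
      exact mul_le_mul_of_nonneg_left (pow_le_pow_left₀ hmplus.le hmplusM 2) h12.le
    have e1 : Q * (2 * (1 + K)) * (9 * (1 + K) * ε ^ 2) = Q * (2 * (1 + K) * (9 * (1 + K) * ε ^ 2)) := by ring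
    linarith only [hε3b, h2, e1]
  have hlinS : M₁ * η * Real.sqrt S ≤ 2 * G₀ := by
    have h1 := mul_le_mul_of_nonneg_left hsqS' (by positivity : (0:ℝ) ≤ M₁ * η)
    have hQterm : 0 ≤ Q * (2 * (1 + K) * κ * M₁ ^ 2) := by positivity
    linarith
  have hquadS : Q * S ≤ 2 * G₀ := by
    rw [hSexp, mul_add]
    have : 0 ≤ M₁ * η * (Real.sqrt (2 * (1 + K)) * Real.sqrt κ * M₁) := by positivity
    have : 0 ≤ 3 * (1 - 2 * γ) * C₁ * ε ^ 3 / 2 := by positivity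
    have : 0 ≤ 3 * ρ ^ 2 * C₃ * ε ^ 2 / μ ^ 2 := by positivity
    linarith
  have hlinabs := abs_le.1 (hlin.trans hlinS)
  have hquad' : -(2 * G₀) ≤ 1 / 2 * ((2 * γ - 1) * ⟪A ξ₁, ξ₁⟫) - (ν + Cν * ‖V Γ₁‖) * ‖ξ₁‖ ^ 2 := by
    have : -(Q * S) ≤ _ := hquad
    linarith
  have hsmall3 : 3 * (1 - 2 * γ) * C₁ * ε ^ 3 / 2 + 3 * ρ ^ 2 * C₃ * ε ^ 2 / μ ^ 2 ≤ G₀ := by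
    have : 0 ≤ Q * (2 * (1 + K) * (9 * (1 + K) * ε ^ 2)) := by positivity
    linarith
  have hstep : Hb z + G₀ ≤ Hb (Y t₁) := by
    linarith only [hexp₁, hlinabs.1, hquad', hland, hgainval, hsmall3, hG₀pos.le]
  have hfinal : Hb z < Hb (Y t₁) := by linarith only [hstep, hG₀pos]
  exact absurd hHlt (not_lt.2 hfinal.le)

end Summit.NavierStokesRegularity.NavierStokesRegularity.Theorems.PowerGaugeEulerLiouville.NodalContinuum
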